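import Summits.BirchSwinnertonDyer.BirchSwinnertonDyer.Theorems.ManinLocalTwoThreeEtaTablesEightyA
import Summits.BirchSwinnertonDyer.BirchSwinnertonDyer.Theorems.ManinLocalTwoThreeNewformPinningEighty
import Summits.BirchSwinnertonDyer.BirchSwinnertonDyer.Theorems.ManinLocalTwoThreeBracketSturmEighty
import Summits.BirchSwinnertonDyer.BirchSwinnertonDyer.Theorems.ManinLocalTwoThreeExistsMinimalOptimalDatum
import Literature.NumberTheory.EllipticCurves.Gamma0RankinSelbergPairing
import HarnessLib

/-!
# Level 80: `|c| = 1` — hence `2 ∤ c` — for EVERY lattice-optimal `X₀(80)`-datum of EVERY globally minimal elliptic curve over `ℚ`, UNCONDITIONALLY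
# (C2 domain, `16 ∣ 80`, genus 7, TWO classes `80a`, `80b`; the newform pinned by the FRICKE SIEVE)

Cell bsd-f2-manin, route `ManinLocalTwoThree` (crux C2 `ManinOddAtFour`, stmt-22967: `2² ∣ 80`), prover seat p2 gen 29; `--supports` (helper).
ASSEMBLY of the level-`80` programme: the seven `η`-quotient cusp forms `C1, …, C7` of the `σ`-closed basis of `S₂(Γ₀(80))` with their kernel tables and
Fricke rows (`…EtaTablesEighty{A,B,C}`) instantiate the abstract pinning `f_eq_eighty_of_basis` (`…NewformPinningEighty`: linear algebra, curve recursion,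
Fricke sieve against `ι₁(40a)` and `ι₁(20a)`), whence `D.f = Σ xᵢCᵢ` (`80a`, `x = (8,1,0,0,0,4,−2)`) or `Σ yᵢCᵢ` (`80b`, `y = (−8,−1,0,0,2,−4,2)`); a BRIDGE by pivot
separation (`eq_of_pivots80`) rewrites these as the SPARSE `η`-combinations **`⇑D.f = C5 − C7′` (`80a`) or `⇑D.f = C5 + C7′` (`80b`)** (`C7′ = η₂η₄²η₂₀²η₄₀/(η₈η₁₀)`,
`…EtaTablesEightyD`; the dense `C2 = η₁²η₄η₅²η₂₀/(η₂η₁₀)` never needs a deep table), and the two Bracket–Sturm certificates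
(`…BracketSturmEighty.abs_maninConstant_eq_one_eighty_of_pinnedA/B`) give **`|c| = 1` and `2 ∤ c` on `X₀(80)`**; the domain is inhabited under the item's binder
`exists_isNewformOf` (`N(80a1) = 80` by kernel Tate certificate).  HONEST FRAMING: unconditional (standard axioms); one
level of C2 — nothing here proves C2 for all `N`, Manin's conjecture or BSD. [cite: AtkinLehner1970, Thm. 3, Thm. 5] [cite: Manin1972, Prop. 1.4]
[cite: Sturm1987, Thm. 1] [cite: AgasheRibetStein2006, §§1–2] [cite: CremonaAlgorithms1997, §2.10, Table 1 (80a1, 80b1), Table 3 (N = 80)] [cite: EdixhovenManin1991, Prop. 2]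
-/

set_option autoImplicit false
-- lint-debt: the directory name repeats the summit name (sibling precedent `ManinLocalTwoThreeManinConstantFortyFive.lean`)
set_option linter.dupNamespace false

noncomputable section

open Complex Filter Topology Set Function
open UpperHalfPlane hiding I
open scoped Real Topology MatrixGroups ModularForm
open ModularForm CongruenceSubgroup
open Literature.NumberTheory.ModularForms
open Literature.NumberTheory.EllipticCurves Literature.NumberTheory.EllipticCurves.ModularForms
open Literature.NumberTheory.Automorphic

namespace Summit.BirchSwinnertonDyer.BirchSwinnertonDyer.Theorems.ManinLocalTwoThree.LevelEighty

/-! ## §1 Reading `cuspCoeff` columns off certified tables -/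

/-- A `q`-coefficient of a cusp form read off its certified integer table (any depth `M`). [folklore] -/
theorem cuspCoeff_of_table {E : CuspForm (Gamma0 80) 2} {e : List ℤ} {M : ℕ} (he : ∀ n < M, ((e.getD n 0 : ℤ) : ℂ) = (qExpansion 1 ⇑E).coeff n)
    (n : ℕ) (hn : n < M) (v : ℤ) (hv : e.getD n 0 = v) : cuspCoeff E n = (v : ℂ) := by
  rw [← hv]
  exact (he n hn).symm

/-! ## §2 The pinning instantiated -/

variable {W : WeierstrassCurve ℚ} [W.IsElliptic]

/-- **THE NEWFORM OF EVERY `X₀(80)`-DATUM, AS A FUNCTION: `⇑D.f = C5 − C7′` (`80a`) or `⇑D.f = C5 + C7′` (`80b`)** (`C5 = η₄²η₈η₁₀η₂₀²/(η₂η₄₀)`,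
`C7′ = η₂η₄²η₂₀²η₄₀/(η₈η₁₀)`) — FACT-FREE: the pinning on the `σ`-closed basis, then pivot separation against the sparse combination.
[cite: AtkinLehner1970, Thm. 3, Thm. 5] [cite: CremonaAlgorithms1997, Table 3 (N = 80)] -/
theorem f_apply_eq_eighty (D : ModularParametrizationData W 80) :
    ⇑D.f = (fun τ ↦ etaQuotient 80 (expFn [(2, -1), (4, 2), (8, 1), (10, 1), (20, 2), (40, -1)]) τ - etaQuotient 80 (expFn [(2, 1), (4, 2), (8, -1), (10, -1), (20, 2), (40, 1)]) τ) ∨ ⇑D.f = (fun τ ↦ etaQuotient 80 (expFn [(2, -1), (4, 2), (8, 1), (10, 1), (20, 2), (40, -1)]) τ + etaQuotient 80 (expFn [(2, 1), (4, 2), (8, -1), (10, -1), (20, 2), (40, 1)]) τ) := by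
  obtain ⟨E1, hE1, t1⟩ := exists_form_C1
  obtain ⟨E2, hE2, t2⟩ := exists_form_C2
  obtain ⟨E3, hE3, t3⟩ := exists_form_C3
  obtain ⟨E4, hE4, t4⟩ := exists_form_C4
  obtain ⟨E5, hE5, t5⟩ := exists_form_C5
  obtain ⟨E6, hE6, t6⟩ := exists_form_C6
  obtain ⟨E7, hE7, t7⟩ := exists_form_C7
  obtain ⟨Es, hEs, ts⟩ := exists_form_C7s
  have s1 : cuspCoeff Es 1 = ((0 : ℤ) : ℂ) := cuspCoeff_of_table ts 1 (by norm_num) (0) (by decide)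
  have s2 : cuspCoeff Es 2 = ((0 : ℤ) : ℂ) := cuspCoeff_of_table ts 2 (by norm_num) (0) (by decide)
  have s3 : cuspCoeff Es 3 = ((1 : ℤ) : ℂ) := cuspCoeff_of_table ts 3 (by norm_num) (1) (by decide)
  have s4 : cuspCoeff Es 4 = ((0 : ℤ) : ℂ) := cuspCoeff_of_table ts 4 (by norm_num) (0) (by decide)
  have s5 : cuspCoeff Es 5 = ((-1 : ℤ) : ℂ) := cuspCoeff_of_table ts 5 (by norm_num) (-1) (by decide)
  have s6 : cuspCoeff Es 6 = ((0 : ℤ) : ℂ) := cuspCoeff_of_table ts 6 (by norm_num) (0) (by decide)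
  have s7 : cuspCoeff Es 7 = ((-3 : ℤ) : ℂ) := cuspCoeff_of_table ts 7 (by norm_num) (-3) (by decide)
  have e1 : cuspCoeff E5 1 = ((1 : ℤ) : ℂ) := cuspCoeff_of_table t5 1 (by norm_num) (1) (by decide)
  have e2 : cuspCoeff E5 2 = ((0 : ℤ) : ℂ) := cuspCoeff_of_table t5 2 (by norm_num) (0) (by decide)
  have e3 : cuspCoeff E5 3 = ((1 : ℤ) : ℂ) := cuspCoeff_of_table t5 3 (by norm_num) (1) (by decide)
  have e4 : cuspCoeff E5 4 = ((0 : ℤ) : ℂ) := cuspCoeff_of_table t5 4 (by norm_num) (0) (by decide)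
  have e5 : cuspCoeff E5 5 = ((0 : ℤ) : ℂ) := cuspCoeff_of_table t5 5 (by norm_num) (0) (by decide)
  have e6 : cuspCoeff E5 6 = ((0 : ℤ) : ℂ) := cuspCoeff_of_table t5 6 (by norm_num) (0) (by decide)
  have e7 : cuspCoeff E5 7 = ((1 : ℤ) : ℂ) := cuspCoeff_of_table t5 7 (by norm_num) (1) (by decide)
  have c1 : (⇑E1 : ℍ → ℂ) = etaQuotient 80 (expFn [(4, 1), (8, -1), (16, 2), (20, 1), (40, -1), (80, 2)]) := funext (hE1)
  have c2 : (⇑E2 : ℍ → ℂ) = etaQuotient 80 (expFn [(1, 2), (2, -1), (4, 1), (5, 2), (10, -1), (20, 1)]) := funext (hE2)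
  have c3 : (⇑E3 : ℍ → ℂ) = etaQuotient 80 (expFn [(8, 2), (40, 2)]) := funext (hE3)
  have c4 : (⇑E4 : ℍ → ℂ) = etaQuotient 80 (expFn [(2, 2), (10, 2)]) := funext (hE4)
  have c5 : (⇑E5 : ℍ → ℂ) = etaQuotient 80 (expFn [(2, -1), (4, 2), (8, 1), (10, 1), (20, 2), (40, -1)]) := funext (hE5)
  have c6 : (⇑E6 : ℍ → ℂ) = etaQuotient 80 (expFn [(4, 1), (5, 2), (8, -1), (10, -1), (16, 2), (20, 1)]) := funext (hE6)
  have c7 : (⇑E7 : ℍ → ℂ) = etaQuotient 80 (expFn [(4, 2), (20, 2)]) := funext (hE7)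
  have h1 := (⟨by exact_mod_cast cuspCoeff_of_table t1 1 (by norm_num) (0) (by decide),
    by exact_mod_cast cuspCoeff_of_table t1 2 (by norm_num) (0) (by decide),
    by exact_mod_cast cuspCoeff_of_table t1 3 (by norm_num) (0) (by decide),
    by exact_mod_cast cuspCoeff_of_table t1 4 (by norm_num) (0) (by decide),
    by exact_mod_cast cuspCoeff_of_table t1 5 (by norm_num) (0) (by decide),
    by exact_mod_cast cuspCoeff_of_table t1 6 (by norm_num) (0) (by decide),
    by exact_mod_cast cuspCoeff_of_table t1 7 (by norm_num) (1) (by decide),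
    by exact_mod_cast cuspCoeff_of_table t1 9 (by norm_num) (0) (by decide),
    by exact_mod_cast cuspCoeff_of_table t1 15 (by norm_num) (0) (by decide),
    by exact_mod_cast cuspCoeff_of_table t1 21 (by norm_num) (0) (by decide),
    by exact_mod_cast cuspCoeff_of_table t1 25 (by norm_num) (0) (by decide),
    by exact_mod_cast cuspCoeff_of_table t1 35 (by norm_num) (1) (by decide),
    by exact_mod_cast cuspCoeff_of_table t1 49 (by norm_num) (0) (by decide)⟩ : cuspCoeff E1 1 = (0 : ℂ) ∧ cuspCoeff E1 2 = (0 : ℂ) ∧ cuspCoeff E1 3 = (0 : ℂ) ∧ cuspCoeff E1 4 = (0 : ℂ) ∧ cuspCoeff E1 5 = (0 : ℂ) ∧ cuspCoeff E1 6 = (0 : ℂ) ∧ cuspCoeff E1 7 = (1 : ℂ) ∧ cuspCoeff E1 9 = (0 : ℂ) ∧ cuspCoeff E1 15 = (0 : ℂ) ∧ cuspCoeff E1 21 = (0 : ℂ) ∧ cuspCoeff E1 25 = (0 : ℂ) ∧ cuspCoeff E1 35 = (1 : ℂ) ∧ cuspCoeff E1 49 = (0 : ℂ))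
  have h2 := (⟨by exact_mod_cast cuspCoeff_of_table t2 1 (by norm_num) (1) (by decide),
    by exact_mod_cast cuspCoeff_of_table t2 2 (by norm_num) (-2) (by decide),
    by exact_mod_cast cuspCoeff_of_table t2 3 (by norm_num) (0) (by decide),
    by exact_mod_cast cuspCoeff_of_table t2 4 (by norm_num) (0) (by decide),
    by exact_mod_cast cuspCoeff_of_table t2 5 (by norm_num) (1) (by decide),
    by exact_mod_cast cuspCoeff_of_table t2 6 (by norm_num) (0) (by decide),
    by exact_mod_cast cuspCoeff_of_table t2 7 (by norm_num) (4) (by decide),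
    by exact_mod_cast cuspCoeff_of_table t2 9 (by norm_num) (-3) (by decide),
    by exact_mod_cast cuspCoeff_of_table t2 15 (by norm_num) (0) (by decide),
    by exact_mod_cast cuspCoeff_of_table t2 21 (by norm_num) (0) (by decide),
    by exact_mod_cast cuspCoeff_of_table t2 25 (by norm_num) (1) (by decide),
    by exact_mod_cast cuspCoeff_of_table t2 35 (by norm_num) (4) (by decide),
    by exact_mod_cast cuspCoeff_of_table t2 49 (by norm_num) (9) (by decide)⟩ : cuspCoeff E2 1 = (1 : ℂ) ∧ cuspCoeff E2 2 = (-2 : ℂ) ∧ cuspCoeff E2 3 = (0 : ℂ) ∧ cuspCoeff E2 4 = (0 : ℂ) ∧ cuspCoeff E2 5 = (1 : ℂ) ∧ cuspCoeff E2 6 = (0 : ℂ) ∧ cuspCoeff E2 7 = (4 : ℂ) ∧ cuspCoeff E2 9 = (-3 : ℂ) ∧ cuspCoeff E2 15 = (0 : ℂ) ∧ cuspCoeff E2 21 = (0 : ℂ) ∧ cuspCoeff E2 25 = (1 : ℂ) ∧ cuspCoeff E2 35 = (4 : ℂ) ∧ cuspCoeff E2 49 = (9 : ℂ))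
  have h3 := (⟨by exact_mod_cast cuspCoeff_of_table t3 1 (by norm_num) (0) (by decide),
    by exact_mod_cast cuspCoeff_of_table t3 2 (by norm_num) (0) (by decide),
    by exact_mod_cast cuspCoeff_of_table t3 3 (by norm_num) (0) (by decide),
    by exact_mod_cast cuspCoeff_of_table t3 4 (by norm_num) (1) (by decide),
    by exact_mod_cast cuspCoeff_of_table t3 5 (by norm_num) (0) (by decide),
    by exact_mod_cast cuspCoeff_of_table t3 6 (by norm_num) (0) (by decide),
    by exact_mod_cast cuspCoeff_of_table t3 7 (by norm_num) (0) (by decide),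
    by exact_mod_cast cuspCoeff_of_table t3 9 (by norm_num) (0) (by decide),
    by exact_mod_cast cuspCoeff_of_table t3 15 (by norm_num) (0) (by decide),
    by exact_mod_cast cuspCoeff_of_table t3 21 (by norm_num) (0) (by decide),
    by exact_mod_cast cuspCoeff_of_table t3 25 (by norm_num) (0) (by decide),
    by exact_mod_cast cuspCoeff_of_table t3 35 (by norm_num) (0) (by decide),
    by exact_mod_cast cuspCoeff_of_table t3 49 (by norm_num) (0) (by decide)⟩ : cuspCoeff E3 1 = (0 : ℂ) ∧ cuspCoeff E3 2 = (0 : ℂ) ∧ cuspCoeff E3 3 = (0 : ℂ) ∧ cuspCoeff E3 4 = (1 : ℂ) ∧ cuspCoeff E3 5 = (0 : ℂ) ∧ cuspCoeff E3 6 = (0 : ℂ) ∧ cuspCoeff E3 7 = (0 : ℂ) ∧ cuspCoeff E3 9 = (0 : ℂ) ∧ cuspCoeff E3 15 = (0 : ℂ) ∧ cuspCoeff E3 21 = (0 : ℂ) ∧ cuspCoeff E3 25 = (0 : ℂ) ∧ cuspCoeff E3 35 = (0 : ℂ) ∧ cuspCoeff E3 49 = (0 : ℂ))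
  have h4 := (⟨by exact_mod_cast cuspCoeff_of_table t4 1 (by norm_num) (1) (by decide),
    by exact_mod_cast cuspCoeff_of_table t4 2 (by norm_num) (0) (by decide),
    by exact_mod_cast cuspCoeff_of_table t4 3 (by norm_num) (-2) (by decide),
    by exact_mod_cast cuspCoeff_of_table t4 4 (by norm_num) (0) (by decide),
    by exact_mod_cast cuspCoeff_of_table t4 5 (by norm_num) (-1) (by decide),
    by exact_mod_cast cuspCoeff_of_table t4 6 (by norm_num) (0) (by decide),
    by exact_mod_cast cuspCoeff_of_table t4 7 (by norm_num) (2) (by decide),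
    by exact_mod_cast cuspCoeff_of_table t4 9 (by norm_num) (1) (by decide),
    by exact_mod_cast cuspCoeff_of_table t4 15 (by norm_num) (2) (by decide),
    by exact_mod_cast cuspCoeff_of_table t4 21 (by norm_num) (-4) (by decide),
    by exact_mod_cast cuspCoeff_of_table t4 25 (by norm_num) (1) (by decide),
    by exact_mod_cast cuspCoeff_of_table t4 35 (by norm_num) (-2) (by decide),
    by exact_mod_cast cuspCoeff_of_table t4 49 (by norm_num) (-3) (by decide)⟩ : cuspCoeff E4 1 = (1 : ℂ) ∧ cuspCoeff E4 2 = (0 : ℂ) ∧ cuspCoeff E4 3 = (-2 : ℂ) ∧ cuspCoeff E4 4 = (0 : ℂ) ∧ cuspCoeff E4 5 = (-1 : ℂ) ∧ cuspCoeff E4 6 = (0 : ℂ) ∧ cuspCoeff E4 7 = (2 : ℂ) ∧ cuspCoeff E4 9 = (1 : ℂ) ∧ cuspCoeff E4 15 = (2 : ℂ) ∧ cuspCoeff E4 21 = (-4 : ℂ) ∧ cuspCoeff E4 25 = (1 : ℂ) ∧ cuspCoeff E4 35 = (-2 : ℂ) ∧ cuspCoeff E4 49 = (-3 : ℂ))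
  have h5 := (⟨by exact_mod_cast cuspCoeff_of_table t5 1 (by norm_num) (1) (by decide),
    by exact_mod_cast cuspCoeff_of_table t5 2 (by norm_num) (0) (by decide),
    by exact_mod_cast cuspCoeff_of_table t5 3 (by norm_num) (1) (by decide),
    by exact_mod_cast cuspCoeff_of_table t5 4 (by norm_num) (0) (by decide),
    by exact_mod_cast cuspCoeff_of_table t5 5 (by norm_num) (0) (by decide),
    by exact_mod_cast cuspCoeff_of_table t5 6 (by norm_num) (0) (by decide),
    by exact_mod_cast cuspCoeff_of_table t5 7 (by norm_num) (1) (by decide),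
    by exact_mod_cast cuspCoeff_of_table t5 9 (by norm_num) (-1) (by decide),
    by exact_mod_cast cuspCoeff_of_table t5 15 (by norm_num) (-1) (by decide),
    by exact_mod_cast cuspCoeff_of_table t5 21 (by norm_num) (-2) (by decide),
    by exact_mod_cast cuspCoeff_of_table t5 25 (by norm_num) (1) (by decide),
    by exact_mod_cast cuspCoeff_of_table t5 35 (by norm_num) (3) (by decide),
    by exact_mod_cast cuspCoeff_of_table t5 49 (by norm_num) (3) (by decide)⟩ : cuspCoeff E5 1 = (1 : ℂ) ∧ cuspCoeff E5 2 = (0 : ℂ) ∧ cuspCoeff E5 3 = (1 : ℂ) ∧ cuspCoeff E5 4 = (0 : ℂ) ∧ cuspCoeff E5 5 = (0 : ℂ) ∧ cuspCoeff E5 6 = (0 : ℂ) ∧ cuspCoeff E5 7 = (1 : ℂ) ∧ cuspCoeff E5 9 = (-1 : ℂ) ∧ cuspCoeff E5 15 = (-1 : ℂ) ∧ cuspCoeff E5 21 = (-2 : ℂ) ∧ cuspCoeff E5 25 = (1 : ℂ) ∧ cuspCoeff E5 35 = (3 : ℂ) ∧ cuspCoeff E5 49 = (3 : ℂ))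
  have h6 := (⟨by exact_mod_cast cuspCoeff_of_table t6 1 (by norm_num) (0) (by decide),
    by exact_mod_cast cuspCoeff_of_table t6 2 (by norm_num) (1) (by decide),
    by exact_mod_cast cuspCoeff_of_table t6 3 (by norm_num) (0) (by decide),
    by exact_mod_cast cuspCoeff_of_table t6 4 (by norm_num) (0) (by decide),
    by exact_mod_cast cuspCoeff_of_table t6 5 (by norm_num) (0) (by decide),
    by exact_mod_cast cuspCoeff_of_table t6 6 (by norm_num) (-1) (by decide),
    by exact_mod_cast cuspCoeff_of_table t6 7 (by norm_num) (-2) (by decide),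
    by exact_mod_cast cuspCoeff_of_table t6 9 (by norm_num) (0) (by decide),
    by exact_mod_cast cuspCoeff_of_table t6 15 (by norm_num) (0) (by decide),
    by exact_mod_cast cuspCoeff_of_table t6 21 (by norm_num) (0) (by decide),
    by exact_mod_cast cuspCoeff_of_table t6 25 (by norm_num) (0) (by decide),
    by exact_mod_cast cuspCoeff_of_table t6 35 (by norm_num) (-2) (by decide),
    by exact_mod_cast cuspCoeff_of_table t6 49 (by norm_num) (0) (by decide)⟩ : cuspCoeff E6 1 = (0 : ℂ) ∧ cuspCoeff E6 2 = (1 : ℂ) ∧ cuspCoeff E6 3 = (0 : ℂ) ∧ cuspCoeff E6 4 = (0 : ℂ) ∧ cuspCoeff E6 5 = (0 : ℂ) ∧ cuspCoeff E6 6 = (-1 : ℂ) ∧ cuspCoeff E6 7 = (-2 : ℂ) ∧ cuspCoeff E6 9 = (0 : ℂ) ∧ cuspCoeff E6 15 = (0 : ℂ) ∧ cuspCoeff E6 21 = (0 : ℂ) ∧ cuspCoeff E6 25 = (0 : ℂ) ∧ cuspCoeff E6 35 = (-2 : ℂ) ∧ cuspCoeff E6 49 = (0 : ℂ))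
  have h7 := (⟨by exact_mod_cast cuspCoeff_of_table t7 1 (by norm_num) (0) (by decide),
    by exact_mod_cast cuspCoeff_of_table t7 2 (by norm_num) (1) (by decide),
    by exact_mod_cast cuspCoeff_of_table t7 3 (by norm_num) (0) (by decide),
    by exact_mod_cast cuspCoeff_of_table t7 4 (by norm_num) (0) (by decide),
    by exact_mod_cast cuspCoeff_of_table t7 5 (by norm_num) (0) (by decide),
    by exact_mod_cast cuspCoeff_of_table t7 6 (by norm_num) (-2) (by decide),
    by exact_mod_cast cuspCoeff_of_table t7 7 (by norm_num) (0) (by decide),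
    by exact_mod_cast cuspCoeff_of_table t7 9 (by norm_num) (0) (by decide),
    by exact_mod_cast cuspCoeff_of_table t7 15 (by norm_num) (0) (by decide),
    by exact_mod_cast cuspCoeff_of_table t7 21 (by norm_num) (0) (by decide),
    by exact_mod_cast cuspCoeff_of_table t7 25 (by norm_num) (0) (by decide),
    by exact_mod_cast cuspCoeff_of_table t7 35 (by norm_num) (0) (by decide),
    by exact_mod_cast cuspCoeff_of_table t7 49 (by norm_num) (0) (by decide)⟩ : cuspCoeff E7 1 = (0 : ℂ) ∧ cuspCoeff E7 2 = (1 : ℂ) ∧ cuspCoeff E7 3 = (0 : ℂ) ∧ cuspCoeff E7 4 = (0 : ℂ) ∧ cuspCoeff E7 5 = (0 : ℂ) ∧ cuspCoeff E7 6 = (-2 : ℂ) ∧ cuspCoeff E7 7 = (0 : ℂ) ∧ cuspCoeff E7 9 = (0 : ℂ) ∧ cuspCoeff E7 15 = (0 : ℂ) ∧ cuspCoeff E7 21 = (0 : ℂ) ∧ cuspCoeff E7 25 = (0 : ℂ) ∧ cuspCoeff E7 35 = (0 : ℂ) ∧ cuspCoeff E7 49 = (0 : ℂ))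
  have w1 : (⇑E1 : ℍ → ℂ) ∣[(2 : ℤ)] (glCast (frickeGL 80 : GL (Fin 2) ℚ) : GL (Fin 2) ℝ) = (((-1 : ℂ) / 8)) • (⇑E2 : ℍ → ℂ) := by
    rw [c1, c2, slash_C1]; congr 1; norm_num
  have w2 : (⇑E2 : ℍ → ℂ) ∣[(2 : ℤ)] (glCast (frickeGL 80 : GL (Fin 2) ℚ) : GL (Fin 2) ℝ) = ((-8 : ℂ)) • (⇑E1 : ℍ → ℂ) := by
    rw [c2, c1]; exact slash_C2
  have w3 : (⇑E3 : ℍ → ℂ) ∣[(2 : ℤ)] (glCast (frickeGL 80 : GL (Fin 2) ℚ) : GL (Fin 2) ℝ) = (((-1 : ℂ) / 4)) • (⇑E4 : ℍ → ℂ) := by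
    rw [c3, c4, slash_C3]; congr 1; norm_num
  have w4 : (⇑E4 : ℍ → ℂ) ∣[(2 : ℤ)] (glCast (frickeGL 80 : GL (Fin 2) ℚ) : GL (Fin 2) ℝ) = ((-4 : ℂ)) • (⇑E3 : ℍ → ℂ) := by
    rw [c4, c3]; exact slash_C4
  have w5 : (⇑E5 : ℍ → ℂ) ∣[(2 : ℤ)] (glCast (frickeGL 80 : GL (Fin 2) ℚ) : GL (Fin 2) ℝ) = ((-1 : ℂ)) • (⇑E5 : ℍ → ℂ) := by
    rw [c5]; exact slash_C5
  have w6 : (⇑E6 : ℍ → ℂ) ∣[(2 : ℤ)] (glCast (frickeGL 80 : GL (Fin 2) ℚ) : GL (Fin 2) ℝ) = ((-1 : ℂ)) • (⇑E6 : ℍ → ℂ) := by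
    rw [c6]; exact slash_C6
  have w7 : (⇑E7 : ℍ → ℂ) ∣[(2 : ℤ)] (glCast (frickeGL 80 : GL (Fin 2) ℚ) : GL (Fin 2) ℝ) = ((-1 : ℂ)) • (⇑E7 : ℍ → ℂ) := by
    rw [c7]; exact slash_C7
  rcases f_eq_eighty_of_basis h1 h2 h3 h4 h5 h6 h7 D w1 w2 w3 w4 w5 w6 w7 with hpin | hpin
  · left
    obtain ⟨c, hc⟩ := exists_coords80 h1 h2 h3 h4 h5 h6 h7 (E5 + (-1 : ℂ) • Es)
    obtain ⟨p1, p2, p3, p4, p5, p6, p7⟩ := coeff_pivots_eightyA h1 h2 h3 h4 h5 h6 h7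
    have hT : E5 + (-1 : ℂ) • Es = ∑ i, ![(8 : ℂ), (1 : ℂ), (0 : ℂ), (0 : ℂ), (0 : ℂ), (4 : ℂ), (-2 : ℂ)] i • ![E1, E2, E3, E4, E5, E6, E7] i := by
      rw [hc]
      refine eq_of_pivots80 h1 h2 h3 h4 h5 h6 h7 c ![(8 : ℂ), (1 : ℂ), (0 : ℂ), (0 : ℂ), (0 : ℂ), (4 : ℂ), (-2 : ℂ)] fun n hn ↦ ?_
      rw [← hc]
      simp only [Finset.mem_insert, Finset.mem_singleton] at hn
      rcases hn with rfl | rfl | rfl | rfl | rfl | rfl | rfl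
      · rw [p1, cuspCoeff_add_smul, e1, s1]; norm_num
      · rw [p2, cuspCoeff_add_smul, e2, s2]; norm_num
      · rw [p3, cuspCoeff_add_smul, e3, s3]; norm_num
      · rw [p4, cuspCoeff_add_smul, e4, s4]; norm_num
      · rw [p5, cuspCoeff_add_smul, e5, s5]; norm_num
      · rw [p6, cuspCoeff_add_smul, e6, s6]; norm_num
      · rw [p7, cuspCoeff_add_smul, e7, s7]; norm_num
    rw [hpin.trans hT.symm]
    funext τ
    rw [CuspForm.add_apply, CuspForm.IsGLPos.smul_apply, smul_eq_mul, hE5 τ, hEs τ]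
    ring
  · right
    obtain ⟨c, hc⟩ := exists_coords80 h1 h2 h3 h4 h5 h6 h7 (E5 + (1 : ℂ) • Es)
    obtain ⟨p1, p2, p3, p4, p5, p6, p7⟩ := coeff_pivots_eightyB h1 h2 h3 h4 h5 h6 h7
    have hT : E5 + (1 : ℂ) • Es = ∑ i, ![(-8 : ℂ), (-1 : ℂ), (0 : ℂ), (0 : ℂ), (2 : ℂ), (-4 : ℂ), (2 : ℂ)] i • ![E1, E2, E3, E4, E5, E6, E7] i := by
      rw [hc]
      refine eq_of_pivots80 h1 h2 h3 h4 h5 h6 h7 c ![(-8 : ℂ), (-1 : ℂ), (0 : ℂ), (0 : ℂ), (2 : ℂ), (-4 : ℂ), (2 : ℂ)] fun n hn ↦ ?_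
      rw [← hc]
      simp only [Finset.mem_insert, Finset.mem_singleton] at hn
      rcases hn with rfl | rfl | rfl | rfl | rfl | rfl | rfl
      · rw [p1, cuspCoeff_add_smul, e1, s1]; norm_num
      · rw [p2, cuspCoeff_add_smul, e2, s2]; norm_num
      · rw [p3, cuspCoeff_add_smul, e3, s3]; norm_num
      · rw [p4, cuspCoeff_add_smul, e4, s4]; norm_num
      · rw [p5, cuspCoeff_add_smul, e5, s5]; norm_num
      · rw [p6, cuspCoeff_add_smul, e6, s6]; norm_num
      · rw [p7, cuspCoeff_add_smul, e7, s7]; norm_num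
    rw [hpin.trans hT.symm]
    funext τ
    rw [CuspForm.add_apply, CuspForm.IsGLPos.smul_apply, smul_eq_mul, hE5 τ, hEs τ]
    ring

/-! ## §3 The headline: `|c| = 1`, `2 ∤ c` on `X₀(80)`, unconditionally -/

/-- **`|c| = 1` for every lattice-optimal `X₀(80)`-datum of every globally minimal elliptic `W/ℚ`** — UNCONDITIONAL (pinning by the Fricke sieve + the class's
Bracket–Sturm certificate with the Néron lattice of `80a1` resp. `80b1`). [cite: Manin1972, Prop. 1.4] [cite: AgasheRibetStein2006, §§1–2]
[cite: CremonaAlgorithms1997, §2.10, Table 1 (80a1, 80b1)] -/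
theorem abs_maninConstant_eq_one_eighty (W : WeierstrassCurve ℚ) [W.IsElliptic] [W.IsGloballyMinimal]
    (D : ModularParametrizationData W 80) (hopt : ∀ z ∈ D.L.lattice, ∃ w ∈ periodLattice D.f, z = D.c * w) :
    |D.maninConstant| = 1 := by
  rcases f_apply_eq_eighty D with hf | hf
  · exact abs_maninConstant_eq_one_eighty_of_pinnedA W D hopt hf
  · exact abs_maninConstant_eq_one_eighty_of_pinnedB W D hopt hf

/-- **C2 `ManinOddAtFour` at `N = 80` (`2² ∣ 80`): `2 ∤ c(D)`** for every lattice-optimal `X₀(80)`-datum — UNCONDITIONAL. [cite: AgasheRibetStein2006, §§1–2] -/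
theorem not_two_dvd_maninConstant_eighty (W : WeierstrassCurve ℚ) [W.IsElliptic] [W.IsGloballyMinimal]
    (D : ModularParametrizationData W 80) (hopt : ∀ z ∈ D.L.lattice, ∃ w ∈ periodLattice D.f, z = D.c * w) :
    ¬ (2 : ℤ) ∣ D.maninConstant := by
  have h := abs_maninConstant_eq_one_eighty W D hopt
  intro h2
  have := Int.le_of_dvd (by rw [h]; norm_num) ((dvd_abs _ _).mpr h2)
  rw [h] at this
  norm_num at this

/-- **No prime divides `c` on `X₀(80)`.** [cite: AgasheRibetStein2006, §§1–2] -/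
theorem not_prime_dvd_maninConstant_eighty (W : WeierstrassCurve ℚ) [W.IsElliptic] [W.IsGloballyMinimal]
    (D : ModularParametrizationData W 80) (hopt : ∀ z ∈ D.L.lattice, ∃ w ∈ periodLattice D.f, z = D.c * w)
    {p : ℕ} (hp : p.Prime) : ¬ (p : ℤ) ∣ D.maninConstant := by
  have h := abs_maninConstant_eq_one_eighty W D hopt
  intro hpd
  have h1 := Int.le_of_dvd (by rw [h]; norm_num) ((dvd_abs _ _).mpr hpd)
  rw [h] at h1
  have := hp.two_le
  omega

/-- **The C2 conclusion on the whole `X₀(80)`-domain**: `2² ∣ 80`, and `|c| = 1 ∧ 2 ∤ c` for every lattice-optimal `X₀(80)`-datum of every globally minimal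
elliptic curve over `ℚ` — UNCONDITIONAL; BSD and C2 for general `N` are NOT proved by this. [folklore] -/
theorem maninOddAtFour_eighty :
    2 ^ 2 ∣ 80 ∧ ∀ (W : WeierstrassCurve ℚ) [W.IsElliptic] [W.IsGloballyMinimal] (D : ModularParametrizationData W 80),
      (∀ z ∈ D.L.lattice, ∃ w ∈ periodLattice D.f, z = D.c * w) → |D.maninConstant| = 1 ∧ ¬ (2 : ℤ) ∣ D.maninConstant :=
  ⟨⟨20, by norm_num⟩, fun W _ _ D hopt ↦ ⟨abs_maninConstant_eq_one_eighty W D hopt, not_two_dvd_maninConstant_eighty W D hopt⟩⟩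

/-! ## §4 The domain is inhabited under the item's binder `exists_isNewformOf` -/

/-- **Modularity at `80a1`, levelled**: under `exists_isNewformOf` the curve `[0, 0, 0, −7, 6]` has a newform in `S₂(Γ₀(80))` (`conductorNorm_eightyA1`).
CONDITIONAL on the item's own binder. [cite: DiamondShurman2005, Thm. 8.8.3] -/
theorem exists_isNewformOf_eightyA1 (hnf : exists_isNewformOf) :
    ∃ f : CuspForm (Gamma0 80) 2, IsNewformOf (⟨0, 0, 0, -7, 6⟩ : WeierstrassCurve ℚ) f := by
  haveI := isElliptic_eightyA1
  have key : ∀ (N : ℕ) [NeZero N], (⟨0, 0, 0, -7, 6⟩ : WeierstrassCurve ℚ).conductorNorm ℤ = N →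
      ∃ f : CuspForm (Gamma0 N) 2, IsNewformOf (⟨0, 0, 0, -7, 6⟩ : WeierstrassCurve ℚ) f := by
    intro N _ hN
    subst hN
    exact hnf _
  haveI : NeZero (80 : ℕ) := ⟨by decide⟩
  exact key 80 conductorNorm_eightyA1

/-- **A lattice-optimal `X₀(80)`-datum on a globally minimal model in the class `80a` exists under modularity**, with `|c| = 1` and `2 ∤ c`; CONDITIONAL on
`exists_isNewformOf` only. [cite: EdixhovenManin1991, Prop. 2] -/
theorem domain_inhabited_eighty_of_modularity (hnf : exists_isNewformOf) :
    ∃ (W₀ : WeierstrassCurve ℚ) (_ : W₀.IsElliptic) (_ : W₀.IsGloballyMinimal) (D₀ : ModularParametrizationData W₀ 80),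
      (⟨0, 0, 0, -7, 6⟩ : WeierstrassCurve ℚ).IsIsogenous W₀ ∧ (∀ z ∈ D₀.L.lattice, ∃ w ∈ periodLattice D₀.f, z = D₀.c * w) ∧
      |D₀.maninConstant| = 1 ∧ ¬ (2 : ℤ) ∣ D₀.maninConstant := by
  haveI := isElliptic_eightyA1
  haveI : NeZero (80 : ℕ) := ⟨by decide⟩
  obtain ⟨f, hf⟩ := exists_isNewformOf_eightyA1 hnf
  obtain ⟨D⟩ := nonempty_modularParametrizationData_of_isNewformOf hf
  obtain ⟨W₀, h₀, hmin, D₀, -, hiso, hopt, -⟩ :=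
    ExistsMinimalOptimalDatum.existsMinimalOptimalDatum_full (⟨0, 0, 0, -7, 6⟩ : WeierstrassCurve ℚ) D
  exact ⟨W₀, h₀, hmin, D₀, hiso, hopt, @abs_maninConstant_eq_one_eighty W₀ h₀ hmin D₀ hopt,
    @not_two_dvd_maninConstant_eighty W₀ h₀ hmin D₀ hopt⟩

end Summit.BirchSwinnertonDyer.BirchSwinnertonDyer.Theorems.ManinLocalTwoThree.LevelEighty

end
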